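import Mathlib
import HarnessLib
import Literature.MathematicalPhysics.QuantumLattice.HubbardGrandCanonicalDensity
import Summits.HubbardSuperconductivity.HubbardSuperconductivity.Theorems.WeakCouplingBCSWcbcsBcsConstructionSubadditiveLimit2D
import Summits.HubbardSuperconductivity.HubbardSuperconductivity.Theorems.WeakCouplingBCSWcbcsBcsConstructionGcGroundEnergyEqMin
import Summits.HubbardSuperconductivity.HubbardSuperconductivity.Theorems.WeakCouplingBCSWcbcsBcsConstructionBoxTiling
import Summits.HubbardSuperconductivity.HubbardSuperconductivity.Theorems.WeakCouplingBCSWcbcsBcsConstructionTorusBoxComparison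

/-!
# WeakCouplingBCS / crux `WcbcsBcsConstruction` — thermodynamic limit of the grand-canonical ground-state energy
# density of the 2D Hubbard model, and the density clause (D) reduced to regularity of the equation of state

Line `lro-seed-kink-bridge` of crux stmt-HubbardSuperconductivity-2010 (lead file). Assembles the wave-2 stubs
`stub_subadditiveLimit2D` (Fekete along squares), `stub_gcGroundEnergyEqMin` (GC = min over sectors),
`stub_boxTiling` (box energetics) and `stub_torusBoxComparison` (torus vs box `O(L)`) into:

* `wcbcs_boxGcEnergyDensityLimit` — the GC ground-state energy density of the free-boundary `L × L` Hubbard box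
  `H(1,U) - μN` converges as `L → ∞`, for every `U, μ`;
* `stub_torusGcEnergyDensityLimit` (registered sub-goal) — the same for the torus `hubbardTorusWith 2 (L+1) 1 U μ`
  (periodic and free boundary conditions have the same limit);
* `stub_densityWindowOfRegularEOS` (registered sub-goal) — the rev-L1 density stub `stub_densityWindow` of the line
  follows from regularity of the limiting equation of state on a sub-window (`stub_regularEquationOfState`, OPEN) via
  Darboux + Griffiths (`exists_tendsto_gcDensity_of_regularWindow`, `HubbardGrandCanonicalDensity.lean`).

Ruelle, *Statistical Mechanics* (1969) §2 (thermodynamic limit by sub-additivity); Griffiths, J. Math. Phys. 5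
(1964) 1215. No definition is introduced (the limit is written with `limUnder`).
-/

set_option linter.dupNamespace false

namespace Summit.HubbardSuperconductivity.HubbardSuperconductivity.Theorems

open Literature.MathematicalPhysics.QuantumLattice Literature.Probability.LatticeModels Matrix Filter
open scoped Matrix.Norms.L2Operator ComplexOrder Topology

/-- **Thermodynamic limit of the grand-canonical ground-state energy density of free-boundary Hubbard boxes**:
for every `U, μ`, `E₀(H_{L+1}(1,U) - μN)/(L+1)²` converges (`H_L` on the `L × L` box, nearest-neighbour graph
pulled back from `ℤ²`). Fekete (`stub_subadditiveLimit2D`) on the box energetics (`stub_boxTiling`, fed with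
`stub_gcGroundEnergyEqMin`). [folklore] -/
theorem wcbcs_boxGcEnergyDensityLimit (U μ : ℝ) :
    ∃ e : ℝ, Tendsto (fun L : ℕ => (hamiltonianWith ((zdGraph 2).comap (fun x : FermionTorus 2 (L + 1) => fun i : Fin 2 => ((ofLex x i : ℕ) : ℤ))) 1 U μ).groundEnergy / ((L + 1 : ℕ) : ℝ) ^ 2) atTop (𝓝 e) := by
  obtain ⟨C, c, hC, hlow, htile, hmono⟩ := stub_boxTiling stub_gcGroundEnergyEqMin U μ
  exact stub_subadditiveLimit2D (fun L => (hamiltonianWith ((zdGraph 2).comap (fun x : FermionTorus 2 L => fun i : Fin 2 => ((ofLex x i : ℕ) : ℤ))) 1 U μ).groundEnergy) C c hC hlow htile hmono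

/-- **Thermodynamic limit of the grand-canonical ground-state energy density of the 2D Hubbard torus**
(registered sub-goal `stub_torusGcEnergyDensityLimit` of crux stmt-HubbardSuperconductivity-2010): for every
`U, μ`, `E₀(hubbardTorusWith 2 (L+1) 1 U μ)/(L+1)²` converges — the box limit (`wcbcs_boxGcEnergyDensityLimit`)
plus `|E_torus - E_box| ≤ C(L+1)` (`stub_torusBoxComparison`). [folklore] -/
theorem stub_torusGcEnergyDensityLimit :
    ∀ U μ : ℝ, ∃ e : ℝ, Tendsto (fun L : ℕ => (hubbardTorusWith 2 (L + 1) 1 U μ).groundEnergy /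
      ((L + 1 : ℕ) : ℝ) ^ 2) atTop (𝓝 e) := by
  intro U μ
  obtain ⟨e, he⟩ := wcbcs_boxGcEnergyDensityLimit U μ
  obtain ⟨C, hC⟩ := stub_torusBoxComparison stub_gcGroundEnergyEqMin U μ
  refine ⟨e, ?_⟩
  have hdiff : Tendsto (fun L : ℕ => ((hubbardTorusWith 2 (L + 1) 1 U μ).groundEnergy - (hamiltonianWith ((zdGraph 2).comap (fun x : FermionTorus 2 (L + 1) => fun i : Fin 2 => ((ofLex x i : ℕ) : ℤ))) 1 U μ).groundEnergy) /
      ((L + 1 : ℕ) : ℝ) ^ 2) atTop (𝓝 0) := by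
    have hbound : ∀ L : ℕ, |((hubbardTorusWith 2 (L + 1) 1 U μ).groundEnergy - (hamiltonianWith ((zdGraph 2).comap (fun x : FermionTorus 2 (L + 1) => fun i : Fin 2 => ((ofLex x i : ℕ) : ℤ))) 1 U μ).groundEnergy) /
        ((L + 1 : ℕ) : ℝ) ^ 2| ≤ |C| * ((((L + 1 : ℕ) : ℝ)) + 1) / ((L + 1 : ℕ) : ℝ) ^ 2 := by
      intro L
      have hL : (0 : ℝ) < ((L + 1 : ℕ) : ℝ) ^ 2 := by positivity
      rw [abs_div, abs_of_pos hL]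
      refine div_le_div_of_nonneg_right ((hC (L + 1)).trans ?_) hL.le
      push_cast
      exact mul_le_mul_of_nonneg_right (le_abs_self C) (by positivity)
    have hmaj : Tendsto (fun L : ℕ => |C| * ((((L + 1 : ℕ) : ℝ)) + 1) / ((L + 1 : ℕ) : ℝ) ^ 2) atTop (𝓝 0) := by
      have h1 : Tendsto (fun L : ℕ => (((L + 1 : ℕ) : ℝ))⁻¹) atTop (𝓝 0) :=
        tendsto_inv_atTop_zero.comp (tendsto_natCast_atTop_atTop.comp (tendsto_add_atTop_nat 1))
      have h2 : Tendsto (fun L : ℕ => |C| * ((((L + 1 : ℕ) : ℝ))⁻¹ + ((((L + 1 : ℕ) : ℝ))⁻¹) ^ 2)) atTop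
          (𝓝 (|C| * (0 + 0 ^ 2))) := (h1.add (h1.pow 2)).const_mul _
      rw [zero_pow two_ne_zero, add_zero, mul_zero] at h2
      refine h2.congr' (Eventually.of_forall fun L => ?_)
      have hL : (((L + 1 : ℕ) : ℝ)) ≠ 0 := by positivity
      field_simp
    exact squeeze_zero_norm (fun L => (Real.norm_eq_abs _).trans_le (hbound L)) hmaj
  have := he.add hdiff
  rw [add_zero] at this
  refine this.congr' (Eventually.of_forall fun L => ?_)
  have hL : (((L + 1 : ℕ) : ℝ)) ^ 2 ≠ 0 := by positivity
  field_simp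
  ring

/-- **The density clause (D) follows from regularity of the limiting equation of state** (registered sub-goal
`stub_densityWindowOfRegularEOS`): IF every doping window `[a,b] ⊂ (0,1/2)` contains a sub-window `[a',b']` such that
for all small `U` the limiting GC ground-state energy density `e(U,·)` (the `limUnder` of the torus densities, which
exists by `stub_torusGcEnergyDensityLimit`) is differentiable across a chemical-potential interval whose end
densities bracket `[1-b',1-a']` (the hypothesis is VERBATIM the open stub `stub_regularEquationOfState` of the line),
THEN the rev-L1 density stub `stub_densityWindow` holds (`δ := a'`; Darboux + Griffiths,
`exists_tendsto_gcDensity_of_regularWindow`). [cite: KomaTasaki1994, §1] -/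
theorem stub_densityWindowOfRegularEOS :
    (∀ a b : ℝ, 0 < a → a < b → b < 1 / 2 → ∃ a' b' : ℝ, a ≤ a' ∧ a' < b' ∧ b' ≤ b ∧ ∃ U₁ : ℝ, 0 < U₁ ∧ ∀ U ∈ Set.Ioo (0:ℝ) U₁, ∃ (e' : ℝ → ℝ) (μ₁ μ₂ : ℝ), μ₁ ≤ μ₂ ∧ (∀ μ' ∈ Set.Icc μ₁ μ₂, HasDerivAt (fun ν : ℝ => limUnder atTop (fun L : ℕ => (hubbardTorusWith 2 (L + 1) 1 U ν).groundEnergy / ((L + 1 : ℕ) : ℝ) ^ 2)) (e' μ') μ') ∧ -e' μ₁ ≤ 1 - b' ∧ 1 - a' ≤ -e' μ₂) →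
    ∀ a b : ℝ, 0 < a → a < b → b < 1 / 2 → ∃ δ ∈ Set.Icc a b, ∃ U₁ : ℝ, 0 < U₁ ∧ ∀ U ∈ Set.Ioo (0:ℝ) U₁, ∃ μ : ℝ, Filter.Tendsto (fun L : ℕ => ((hubbardTorusWith 2 (L + 1) 1 U μ).groundStateFunctional totalNumber).re / ((L + 1 : ℕ) : ℝ) ^ 2) Filter.atTop (nhds (1 - δ)) := by
  intro hreg a b ha hab hb
  obtain ⟨a', b', haa', hab', hb'b, U₁, hU₁, hwin⟩ := hreg a b ha hab hb
  refine ⟨a', ⟨haa', hab'.le.trans hb'b⟩, U₁, hU₁, fun U hU => ?_⟩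
  obtain ⟨e', μ₁, μ₂, h12, hder, h₁, h₂⟩ := hwin U hU
  have hlim : ∀ μ' : ℝ, Tendsto (fun L : ℕ => (hubbardTorusWith 2 (L + 1) 1 U μ').groundEnergy /
      ((L + 1 : ℕ) : ℝ) ^ 2) atTop (𝓝 ((fun ν : ℝ => limUnder atTop (fun L : ℕ => (hubbardTorusWith 2 (L + 1) 1 U ν).groundEnergy / ((L + 1 : ℕ) : ℝ) ^ 2)) μ')) := fun μ' =>
    tendsto_nhds_limUnder (stub_torusGcEnergyDensityLimit U μ')
  obtain ⟨μ, -, hμ⟩ := exists_tendsto_gcDensity_of_regularWindow 1 U h12 hlim hder h₁ h₂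
    (δ := a') ⟨le_rfl, hab'.le⟩
  exact ⟨μ, hμ⟩

end Summit.HubbardSuperconductivity.HubbardSuperconductivity.Theorems
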